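import Summits.BirchSwinnertonDyer.BirchSwinnertonDyer.Theorems.EisensteinPrimesMazurMCOnCellBTwistbackTwistDoorClassNumber
import Summits.BirchSwinnertonDyer.BirchSwinnertonDyer.Theorems.EisensteinPrimesMazurMCOnCellBTwistbackBalanceOneDoor
import HarnessLib

/-!
# Crux 3 `MazurMCOnCellB` (stmt-BirchSwinnertonDyer-19033), line `twistback` v4 — the TWIST DOOR FROM THE
# `W`-SIDE, part 4: the COMPOSITIONS — stub 6's conclusion at a non-split X2b pair from the line datum of `W`,
# and at `p = 3` the ∀-hypothesis `hDict` of w5's field-supply door DISCHARGED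

Width seat bsd-line-x2-p1-w3 (gen 9), cell `bsd-eis` (run/shared/lean/pub/bsd-eis/), 2026-08-28. HONEST FRAMING:
THEOREMS ONLY (no `def`, no named fact introduced, no `sorry`); compositions of parts 1–3 of this door with LEAD g10's
p645525 §3 and width seat w5's p652304; CONDITIONAL on the named facts those doors take BY NAME (`PublishedInputs` =
stmt-…-19037, Disegni 2020 Thm. 4(1), Greenberg–Vatsal Thm. (3.11) — PUB; for §2 also Dokchitser–Dokchitser Thm. 1.4 and
Nakagawa–Horie 1988 Thm. 1 + Taya 2000 — PUB — and Keller–Yin 2024 Thm. E, UNREFEREED PREPRINT); `--supports`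
stmt-BirchSwinnertonDyer-19033; closes no stub by itself (the `W`-side line datum, the Weil relation, `ψ(3) ≠ 1` and
the balance `1` remain per pair / per class); no summit statement, no Mazur main conjecture and no BSD is proved for any
curve; 0 cells / labels / tiers move.

* §1 `upperPartner_at_of_classNumber_twist_of_lineRamifiedOdd` / `…_of_lineUnramifiedEven` (any odd `p`): p645525 §3's
  conclusion (stub 6 AT `(W, p)`) from ONE admissible `K` with `r_an(W^{(d_K)}) = 1`, the line datum of `W`, the Weil
  relation, `ψ(p) ≠ 1` (resp. `φ(p) ≠ 1`), the `W`-balance and ONE class number.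
* §2 `upperPartner_at_three_of_lineRamifiedOdd_of_thmE` / `…_of_lineUnramifiedEven_of_thmE` (`p = 3`): w5's
  `upperPartner_at_three_of_dictionary_of_thmE` with `hDict` DISCHARGED — the field, its class number, `r_an = 1` and the
  coprimality all come from the supply / the certificate; what is fed in is the line datum of `W` (with `m ∣ 3d` resp.
  `d ∣ 3m` and the even character's conductor a positive fundamental discriminant), the Weil relation (w7 derives it),
  `ψ(3) ≠ 1` resp. `φ(3) ≠ 1` (= non-split, w7), the bad places `S₀` and the balance `1` («c(E) = 1», lam-a: 30/44 A10
  non-split cells).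

References: [GreenbergVatsal2000] Thm. (1.3), §2 p. 28, §3 Thm. (3.11), (28); [Disegni2020] Thm. 4; [Wuthrich2014] Thm. 16;
[DokchitserDokchitserAnnals2010] Thm. 1.4; [NakagawaHorie1988] Thm. 1; [KellerYin2024] Thm. E (PRE); [Washington1997] Thm.
4.17; [KrizLi2019] §4, §9 (the supply; not used beyond w6's named fact).
-/

set_option autoImplicit false

-- `Summit.BirchSwinnertonDyer.BirchSwinnertonDyer.…`: the summit and its single sub-problem share a name.
set_option linter.dupNamespace false

noncomputable section

open scoped Classical NumberTheorySymbols

open WeierstrassCurve NumberField IsDedekindDomain Field DirichletCharacter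
  Literature.NumberTheory.EllipticCurves Literature.NumberTheory.GaloisRepresentations
  Literature.NumberTheory.EllipticCurves.GreenbergVatsal2000
  Literature.NumberTheory.EllipticCurves.Rank1Residual Literature.NumberTheory.EllipticCurves.Rank1Residual.Typed
  Literature.NumberTheory.EllipticCurves.Disegni2020 Literature.NumberTheory.EllipticCurves.KellerYin2024
  Literature.NumberTheory.QuadraticFields Literature.NumberTheory.QuadraticFields.Quadratic
  Summit.BirchSwinnertonDyer.Rank1Residual Summit.BirchSwinnertonDyer.Rank1Residual.X2
  Summit.BirchSwinnertonDyer.BirchSwinnertonDyer.Theses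
  Summit.BirchSwinnertonDyer.BirchSwinnertonDyer.Theorems.EisensteinPrimesMazurMCOnCellBTwistbackTwistLineCharacters
  Summit.BirchSwinnertonDyer.BirchSwinnertonDyer.Theorems.EisensteinPrimesMazurMCOnCellBTwistbackQuadraticRadical
  Summit.BirchSwinnertonDyer.BirchSwinnertonDyer.Theorems.EisensteinPrimesMazurMCOnCellBTwistbackKLFlatPartner
  Summit.BirchSwinnertonDyer.BirchSwinnertonDyer.Theorems.EisensteinPrimesMazurMCOnCellBTwistbackPartnerClassNumberLift
  Summit.BirchSwinnertonDyer.BirchSwinnertonDyer.Theorems.EisensteinPrimesMazurMCOnCellBTwistbackTwistDoor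
  Summit.BirchSwinnertonDyer.BirchSwinnertonDyer.Theorems.EisensteinPrimesMazurMCOnCellBTwistbackTwistDoorClassNumber

namespace Summit.BirchSwinnertonDyer.BirchSwinnertonDyer.Theorems.EisensteinPrimesMazurMCOnCellBTwistbackTwistDoorDictionary

/-! ## §1. Stub 6's conclusion at a non-split X2b pair from the `W`-side data and ONE class number -/

/-- **Stub 6's conclusion AT a NON-split X2b pair `(W, p)`, FIRST SHAPE, CLASS-NUMBER FORM**: p645525 §3
(`upperPartner_at_of_klFlat_partner`, VERBATIM conclusion) with its carrier clause discharged by part 3's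
`klFlatCarrier_twist_of_lineRamifiedOdd_of_classNumber`. Per-pair inputs: ONE admissible `K` (Heegner for `N_W` and `p`,
`d_K` odd `< −4`, `r_an(W^{(d_K)}) = 1`), the ramified-odd line datum `(φ, ψ)` of `W` with `ψ` even quadratic-valued,
the Weil relation, `ψ(p) ≠ 1`, the balance `1 + Σ_{S₀} δ_W = Σ_{S₀} s([φ=ℓ̄]+[ψ=ℓ̄])`, and ONE class number
`p ∤ h(d·d_K)`. Conditional on `PublishedInputs`, Disegni Thm. 4(1), GV Thm. (3.11) (named facts); no summit statement /
main conjecture / BSD proved; the existence of such `K` is not proved here.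
[cite: GreenbergVatsal2000, Thm. (1.3), §2 p. 28, §3 Thm. (3.11) and (28)] [cite: Disegni2020, Thm. 4 (§3.2)]
[cite: Wuthrich2014, Thm. 16 (p. 397)] [cite: Washington1997, Thm. 4.17] [cite: KrizLi2019, §4 (the supply of K; not used)] -/
theorem upperPartner_at_of_classNumber_twist_of_lineRamifiedOdd (hP : EisensteinPrimes.PublishedInputs)
    (hDis : padicBSD_rankOne_nonsplitMult) (h311 : thm311_hasUnitContent_iff_and_order_eq_of_lineRamifiedEven)
    (W : WeierstrassCurve ℚ) [W.IsElliptic] [W.IsGloballyMinimal] (p : ℕ) [Fact p.Prime]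
    (hc : X2.CellB W p) (hns : ¬ W.HasSplitMultiplicativeReductionAtPrime p)
    (K : Type) [Field K] [NumberField K] (hK : IsImaginaryQuadratic K)
    (hHN : SatisfiesHeegnerHypothesis (W.conductorNorm ℤ) K) (hHp : SatisfiesHeegnerHypothesis p K)
    (hodd : Odd (NumberField.discr K)) (hlt : NumberField.discr K < -4)
    (hr1 : (W.quadraticTwist (NumberField.discr K : ℚ)).analyticRank = 1)
    [NeZero (NumberField.discr K).natAbs] (χ : MulChar (ZMod (NumberField.discr K).natAbs) ℤ)
    (hχJ : ∀ a : ℕ, χ (a : ZMod (NumberField.discr K).natAbs) = J((a : ℤ) | (NumberField.discr K).natAbs))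
    {Φ₀ : AddSubgroup (geomTorsion W (p : ℤ))} (hΦ : IsRationalLine W p Φ₀)
    (hram : ¬ LineUnramifiedAt W p Φ₀) (hoddL : LineOdd W p Φ₀)
    {m : ℕ} [NeZero m] (φ : DirichletCharacter (ZMod p) m) {d : ℕ} [NeZero d]
    (ψ : DirichletCharacter (ZMod p) d) (hφ : φ.IsPrimitive) (hψ : ψ.IsPrimitive) (hpm : p ∣ m)
    (hpd : ¬ p ∣ d)
    (hmD : m.Coprime (NumberField.discr K).natAbs) (hdD : d.Coprime (NumberField.discr K).natAbs)
    (hφ0 : ∀ (σ : absoluteGaloisGroup ℚ), ∀ P ∈ Φ₀,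
      σ • P = (φ ((modNCyclotomicCharacter ℚ m σ : (ZMod m)ˣ) : ZMod m)).val • P)
    (hψ0 : ∀ (σ : absoluteGaloisGroup ℚ) (P : geomTorsion W (p : ℤ)),
      σ • P - (ψ ((modNCyclotomicCharacter ℚ d σ : (ZMod d)ˣ) : ZMod d)).val • P ∈ Φ₀)
    (S₀ : Finset (HeightOneSpectrum (𝓞 ℚ))) (hS₀p : ∀ v ∈ S₀, ((p : ℕ) : 𝓞 ℚ) ∉ v.asIdeal)
    (hS₀N : ∀ v ∈ S₀, Rat.HeightOneSpectrum.natGenerator v ∣ W.conductorNorm ℤ)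
    (hS : ∀ v : HeightOneSpectrum (𝓞 ℚ), v ∉ S₀ → ((p : ℕ) : 𝓞 ℚ) ∉ v.asIdeal → W.HasGoodReductionAt v)
    (hψq : ψ.IsQuadratic) (hψe : ψ.Even)
    (hφψ : ∀ a : ℕ, ¬ p ∣ a → φ (a : ZMod m) * (a : ZMod p)⁻¹ = ψ⁻¹ (a : ZMod d))
    (hψp : ψ (p : ZMod d) ≠ 1) (hh : ¬ p ∣ BinaryQuadraticForm.classNumber ((d : ℤ) * NumberField.discr K))
    (hbal : 1 + ∑ v ∈ S₀, delta W p v =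
      ∑ v ∈ S₀, ((if φ (Rat.HeightOneSpectrum.natGenerator v : ZMod m) =
            (Rat.HeightOneSpectrum.natGenerator v : ZMod p)
          then sFactor p (Rat.HeightOneSpectrum.natGenerator v) else 0) +
        (if ψ (Rat.HeightOneSpectrum.natGenerator v : ZMod d) =
            (Rat.HeightOneSpectrum.natGenerator v : ZMod p)
          then sFactor p (Rat.HeightOneSpectrum.natGenerator v) else 0))) :
    ∃ (K : Type) (_ : Field K) (_ : NumberField K), IsImaginaryQuadratic K ∧
      SatisfiesHeegnerHypothesis (W.conductorNorm ℤ) K ∧ SatisfiesHeegnerHypothesis p K ∧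
      Odd (NumberField.discr K) ∧ NumberField.discr K < -4 ∧
      (W.quadraticTwist (NumberField.discr K : ℚ)).analyticRank = 1 ∧
      ∀ (Wd : WeierstrassCurve ℚ) [Wd.IsElliptic] [Wd.IsGloballyMinimal],
        (∃ C : VariableChange ℚ, C • Wd = W.quadraticTwist (NumberField.discr K : ℚ)) →
        MissingUpperBoundAt Wd p :=
  upperPartner_at_of_klFlat_partner hP hDis h311 W p hc hns K hK hHN hHp hodd hlt hr1 fun Wd _ _ hWd ↦ by
    obtain ⟨C, hC⟩ := hWd
    exact klFlatCarrier_twist_of_lineRamifiedOdd_of_classNumber W hc.2.1.1 K hK hodd hHN hHp χ hχJ hΦ hram hoddL φ ψ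
      hφ hψ hpm hpd hmD hdD hφ0 hψ0 S₀ hS₀p hS₀N hS hψq hψe hφψ hψp hlt hh 1 hbal Wd C hC

/-- **Stub 6's conclusion AT a NON-split X2b pair `(W, p)`, SECOND SHAPE, CLASS-NUMBER FORM**: p645525 §3 with its
carrier clause discharged by part 3's `klFlatCarrier_twist_of_lineUnramifiedEven_of_classNumber` (line of `W`
unramified-even, `φ` even quadratic-valued, `φ(p) ≠ 1`, ONE class number `p ∤ h(m·d_K)`). Same honest framing.
[cite: GreenbergVatsal2000, Thm. (1.3), §2 p. 28, §3 Thm. (3.11) and (28)] [cite: Disegni2020, Thm. 4 (§3.2)]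
[cite: Wuthrich2014, Thm. 16 (p. 397)] [cite: SilvermanATAEC1994, Thm. V.5.3, Cor. V.5.4] [cite: Washington1997, Thm. 4.17] -/
theorem upperPartner_at_of_classNumber_twist_of_lineUnramifiedEven (hP : EisensteinPrimes.PublishedInputs)
    (hDis : padicBSD_rankOne_nonsplitMult) (h311 : thm311_hasUnitContent_iff_and_order_eq_of_lineRamifiedEven)
    (W : WeierstrassCurve ℚ) [W.IsElliptic] [W.IsGloballyMinimal] (p : ℕ) [Fact p.Prime]
    (hc : X2.CellB W p) (hns : ¬ W.HasSplitMultiplicativeReductionAtPrime p)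
    (K : Type) [Field K] [NumberField K] (hK : IsImaginaryQuadratic K)
    (hHN : SatisfiesHeegnerHypothesis (W.conductorNorm ℤ) K) (hHp : SatisfiesHeegnerHypothesis p K)
    (hodd : Odd (NumberField.discr K)) (hlt : NumberField.discr K < -4)
    (hr1 : (W.quadraticTwist (NumberField.discr K : ℚ)).analyticRank = 1)
    [NeZero (NumberField.discr K).natAbs] (χ : MulChar (ZMod (NumberField.discr K).natAbs) ℤ)
    (hχJ : ∀ a : ℕ, χ (a : ZMod (NumberField.discr K).natAbs) = J((a : ℤ) | (NumberField.discr K).natAbs))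
    {Φ₀ : AddSubgroup (geomTorsion W (p : ℤ))} (hΦ : IsRationalLine W p Φ₀)
    (hunr : LineUnramifiedAt W p Φ₀) (hevenL : LineEven W p Φ₀)
    {m : ℕ} [NeZero m] (φ : DirichletCharacter (ZMod p) m) {d : ℕ} [NeZero d]
    (ψ : DirichletCharacter (ZMod p) d) (hφ : φ.IsPrimitive) (hψ : ψ.IsPrimitive) (hpm : ¬ p ∣ m)
    (hpd : p ∣ d)
    (hmD : m.Coprime (NumberField.discr K).natAbs) (hdD : d.Coprime (NumberField.discr K).natAbs)
    (hφ0 : ∀ (σ : absoluteGaloisGroup ℚ), ∀ P ∈ Φ₀,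
      σ • P = (φ ((modNCyclotomicCharacter ℚ m σ : (ZMod m)ˣ) : ZMod m)).val • P)
    (hψ0 : ∀ (σ : absoluteGaloisGroup ℚ) (P : geomTorsion W (p : ℤ)),
      σ • P - (ψ ((modNCyclotomicCharacter ℚ d σ : (ZMod d)ˣ) : ZMod d)).val • P ∈ Φ₀)
    (S₀ : Finset (HeightOneSpectrum (𝓞 ℚ))) (hS₀p : ∀ v ∈ S₀, ((p : ℕ) : 𝓞 ℚ) ∉ v.asIdeal)
    (hS₀N : ∀ v ∈ S₀, Rat.HeightOneSpectrum.natGenerator v ∣ W.conductorNorm ℤ)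
    (hS : ∀ v : HeightOneSpectrum (𝓞 ℚ), v ∉ S₀ → ((p : ℕ) : 𝓞 ℚ) ∉ v.asIdeal → W.HasGoodReductionAt v)
    (hφq : φ.IsQuadratic) (hφe : φ.Even)
    (hφψ : ∀ a : ℕ, ¬ p ∣ a → φ (a : ZMod m) * (a : ZMod p)⁻¹ = ψ⁻¹ (a : ZMod d))
    (hφp : φ (p : ZMod m) ≠ 1) (hh : ¬ p ∣ BinaryQuadraticForm.classNumber ((m : ℤ) * NumberField.discr K))
    (hbal : 1 + ∑ v ∈ S₀, delta W p v =
      ∑ v ∈ S₀, ((if φ (Rat.HeightOneSpectrum.natGenerator v : ZMod m) =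
            (Rat.HeightOneSpectrum.natGenerator v : ZMod p)
          then sFactor p (Rat.HeightOneSpectrum.natGenerator v) else 0) +
        (if ψ (Rat.HeightOneSpectrum.natGenerator v : ZMod d) =
            (Rat.HeightOneSpectrum.natGenerator v : ZMod p)
          then sFactor p (Rat.HeightOneSpectrum.natGenerator v) else 0))) :
    ∃ (K : Type) (_ : Field K) (_ : NumberField K), IsImaginaryQuadratic K ∧
      SatisfiesHeegnerHypothesis (W.conductorNorm ℤ) K ∧ SatisfiesHeegnerHypothesis p K ∧
      Odd (NumberField.discr K) ∧ NumberField.discr K < -4 ∧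
      (W.quadraticTwist (NumberField.discr K : ℚ)).analyticRank = 1 ∧
      ∀ (Wd : WeierstrassCurve ℚ) [Wd.IsElliptic] [Wd.IsGloballyMinimal],
        (∃ C : VariableChange ℚ, C • Wd = W.quadraticTwist (NumberField.discr K : ℚ)) →
        MissingUpperBoundAt Wd p :=
  upperPartner_at_of_klFlat_partner hP hDis h311 W p hc hns K hK hHN hHp hodd hlt hr1 fun Wd _ _ hWd ↦ by
    obtain ⟨C, hC⟩ := hWd
    exact klFlatCarrier_twist_of_lineUnramifiedEven_of_classNumber W hc.2.1.1 hc.2.1.2.2 K hK hodd hHN hHp χ hχJ hΦ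
      hunr hevenL φ ψ hφ hψ hpm hpd hmD hdD hφ0 hψ0 S₀ hS₀p hS₀N hS hφq hφe hφψ hφp hlt hh 1 hbal Wd C hC

/-! ## §2. At `p = 3`: w5's `hDict` DISCHARGED — stub 6 at a non-split X2b pair from the `W`-side line datum alone -/

/-- **Stub 6 at a NON-split X2b pair `(W, 3)` from the `W`-SIDE LINE DATUM, FIRST SHAPE — w5's
`upperPartner_at_three_of_dictionary_of_thmE` (p652304) with its ∀-hypothesis `hDict` DISCHARGED.** Data about `W` ONLY:
`X2.CellB W 3`, `3` non-split; a rational `3`-line `Φ₀` RAMIFIED at `3` and ODD with primitive characters `φ` mod `m`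
(`3 ∣ m`, `m ∣ 3d`) and `ψ` mod `d` (`3 ∤ d`; `ψ` EVEN; `d` a positive fundamental discriminant — that of `ψ`); the Weil
relation `φ(a)a⁻¹ = ψ⁻¹(a)` (`3 ∤ a`); `ψ(3) ≠ 1` («non-split»); a set of bad places `S₀ ∌ (3)` off which `W` is good;
the balance `1 + Σ_{S₀} δ_W = Σ_{S₀} s([φ=ℓ̄]+[ψ=ℓ̄])` («c(E) = 1»). NO per-`K` input: for every admissible `K` of the
Nakagawa–Horie–Taya supply (inside p652304: Heegner for `N_W`, `3`, `2`; `d_K` odd `< −4`; `gcd(d_K, d) = 1`;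
`3 ∤ h(d·d_K)`) part 3's class-number door supplies the carrier (`gcd(m, d_K) = 1` from `m ∣ 3d`, `3 ∤ d_K`;
quadratic-valuedness is automatic over `𝔽₃`). Conditional on the named facts of p652304 (`PublishedInputs`, Disegni
Thm. 4(1), GV Thm. (3.11), Dokchitser–Dokchitser (PUB); Keller–Yin Thm. E (PRE); Nakagawa–Horie–Taya (PUB)); no summit
statement / main conjecture / BSD is proved for any curve; 0 cells move.
[claim: KellerYin2024, status: under-review] [cite: NakagawaHorie1988, Thm. 1] [cite: GreenbergVatsal2000, Thm. (1.3), §2 p. 28, §3 Thm. (3.11), (28)]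
[cite: Disegni2020, Thm. 4 (§3.2)] [cite: Wuthrich2014, Thm. 16 (p. 397)] [cite: DokchitserDokchitserAnnals2010, Thm. 1.4]
[cite: Washington1997, Thm. 4.17] -/
theorem upperPartner_at_three_of_lineRamifiedOdd_of_thmE
    (hP : EisensteinPrimes.PublishedInputs)
    (hDis : padicBSD_rankOne_nonsplitMult) (h311 : thm311_hasUnitContent_iff_and_order_eq_of_lineRamifiedEven)
    (hDD : ∀ (V : WeierstrassCurve ℚ) [V.IsElliptic] (ℓ : ℕ) [Fact ℓ.Prime], selmerCorank_mod_two_eq V ℓ)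
    (hKY : thmE_pConverse_semistable_OPEN)
    (hNH : Literature.NumberTheory.QuadraticFields.nakagawaHorie_taya_exists_imaginary_h3_eq_one)
    (W : WeierstrassCurve ℚ) [W.IsElliptic] [W.IsGloballyMinimal]
    (hc : X2.CellB W 3) (hns : ¬ W.HasSplitMultiplicativeReductionAtPrime 3)
    {Φ₀ : AddSubgroup (geomTorsion W ((3 : ℕ) : ℤ))} (hΦ : IsRationalLine W 3 Φ₀)
    (hram : ¬ LineUnramifiedAt W 3 Φ₀) (hoddL : LineOdd W 3 Φ₀)
    {m : ℕ} [NeZero m] (φ : DirichletCharacter (ZMod 3) m) {d : ℕ} [NeZero d]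
    (ψ : DirichletCharacter (ZMod 3) d) (hφ : φ.IsPrimitive) (hψ : ψ.IsPrimitive) (h3m : 3 ∣ m)
    (h3d : ¬ 3 ∣ d) (hm3d : m ∣ 3 * d)
    (hDf : ((d : ℤ) % 4 = 1 ∧ Squarefree (d : ℤ) ∧ (d : ℤ) ≠ 1) ∨
      (4 ∣ (d : ℤ) ∧ ((d : ℤ) / 4 % 4 = 2 ∨ (d : ℤ) / 4 % 4 = 3) ∧ Squarefree ((d : ℤ) / 4)))
    (hφ0 : ∀ (σ : absoluteGaloisGroup ℚ), ∀ P ∈ Φ₀,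
      σ • P = (φ ((modNCyclotomicCharacter ℚ m σ : (ZMod m)ˣ) : ZMod m)).val • P)
    (hψ0 : ∀ (σ : absoluteGaloisGroup ℚ) (P : geomTorsion W ((3 : ℕ) : ℤ)),
      σ • P - (ψ ((modNCyclotomicCharacter ℚ d σ : (ZMod d)ˣ) : ZMod d)).val • P ∈ Φ₀)
    (S₀ : Finset (HeightOneSpectrum (𝓞 ℚ))) (hS₀p : ∀ v ∈ S₀, ((3 : ℕ) : 𝓞 ℚ) ∉ v.asIdeal)
    (hS₀N : ∀ v ∈ S₀, Rat.HeightOneSpectrum.natGenerator v ∣ W.conductorNorm ℤ)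
    (hS : ∀ v : HeightOneSpectrum (𝓞 ℚ), v ∉ S₀ → ((3 : ℕ) : 𝓞 ℚ) ∉ v.asIdeal → W.HasGoodReductionAt v)
    (hψe : ψ.Even) (hψ3 : ψ (3 : ZMod d) ≠ 1)
    (hφψ : ∀ a : ℕ, ¬ 3 ∣ a → φ (a : ZMod m) * (a : ZMod 3)⁻¹ = ψ⁻¹ (a : ZMod d))
    (hbal : 1 + ∑ v ∈ S₀, delta W 3 v =
      ∑ v ∈ S₀, ((if φ (Rat.HeightOneSpectrum.natGenerator v : ZMod m) =
            (Rat.HeightOneSpectrum.natGenerator v : ZMod 3)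
          then sFactor 3 (Rat.HeightOneSpectrum.natGenerator v) else 0) +
        (if ψ (Rat.HeightOneSpectrum.natGenerator v : ZMod d) =
            (Rat.HeightOneSpectrum.natGenerator v : ZMod 3)
          then sFactor 3 (Rat.HeightOneSpectrum.natGenerator v) else 0))) :
    ∃ (K : Type) (_ : Field K) (_ : NumberField K), IsImaginaryQuadratic K ∧
      SatisfiesHeegnerHypothesis (W.conductorNorm ℤ) K ∧ SatisfiesHeegnerHypothesis 3 K ∧
      Odd (NumberField.discr K) ∧ NumberField.discr K < -4 ∧
      (W.quadraticTwist (NumberField.discr K : ℚ)).analyticRank = 1 ∧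
      ∀ (Wd : WeierstrassCurve ℚ) [Wd.IsElliptic] [Wd.IsGloballyMinimal],
        (∃ C : VariableChange ℚ, C • Wd = W.quadraticTwist (NumberField.discr K : ℚ)) →
        MissingUpperBoundAt Wd 3 := by
  have h3P : (3 : ℕ).Prime := Fact.out
  refine EisensteinPrimesMazurMCOnCellBTwistbackBalanceOneDoor.upperPartner_at_three_of_dictionary_of_thmE hP hDis h311
    hDD hKY hNH W hc hns (D := (d : ℤ)) (by exact_mod_cast Nat.pos_of_ne_zero (NeZero.ne d)) hDf ?_
  intro K _ _ hK hHN hH3 _ hodd hlt _ hcop hh _ Wd _ _ hWd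
  obtain ⟨C, hC⟩ := hWd
  have h2 : Module.finrank ℚ K = 2 := hK.1
  haveI : NeZero (NumberField.discr K).natAbs := ⟨Int.natAbs_ne_zero.mpr (NumberField.discr_ne_zero K)⟩
  obtain ⟨hD4, hsqN⟩ := discr_emod_four_eq_one_and_squarefree_natAbs_of_odd h2 hodd
  obtain ⟨χ, -, -, hχJ, -⟩ := exists_quadraticChar_geomSqrt_of_emod_four (p := 3) (by decide) hD4 hsqN
  -- coprimality of the conductors with `d_K`: `gcd(d_K, D) = 1` from the supply, `3 ∤ d_K` since `3` splits
  have hDcop : d.Coprime (NumberField.discr K).natAbs := by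
    have h := (Int.isCoprime_iff_nat_coprime.mp hcop).symm
    rwa [Int.natAbs_natCast] at h
  have h3cop : (3 : ℕ).Coprime (NumberField.discr K).natAbs :=
    (Nat.Prime.coprime_iff_not_dvd h3P).mpr fun h ↦
      Literature.SatisfiesHeegnerHypothesis.not_dvd_discr h2 hH3 h3P dvd_rfl (Int.natCast_dvd.mpr h)
  have hOcop : m.Coprime (NumberField.discr K).natAbs :=
    Nat.Coprime.coprime_dvd_left hm3d (Nat.Coprime.mul_left h3cop hDcop)
  exact klFlatCarrier_twist_of_lineRamifiedOdd_of_classNumber W (p := 3) (by decide) K hK hodd hHN hH3 χ hχJ hΦ hram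
    hoddL φ ψ hφ hψ h3m h3d hOcop hDcop hφ0 hψ0 S₀ hS₀p hS₀N hS (isQuadratic_of_zmod_three ψ) hψe hφψ hψ3 hlt hh 1
    hbal Wd C hC

/-- **Stub 6 at a NON-split X2b pair `(W, 3)` from the `W`-SIDE LINE DATUM, SECOND SHAPE** — p652304 with `hDict`
DISCHARGED by part 3's second-shape class-number door: the `3`-line of `W` UNRAMIFIED-EVEN with primitive `φ` mod `m`
(`3 ∤ m`; `φ` EVEN; `m` a positive fundamental discriminant), `ψ` mod `d` (`3 ∣ d`, `d ∣ 3m`), the Weil relation,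
`φ(3) ≠ 1`, `S₀`, the balance; the supply runs with `D = m`. Same honest framing as the first shape.
[claim: KellerYin2024, status: under-review] [cite: NakagawaHorie1988, Thm. 1] [cite: GreenbergVatsal2000, Thm. (1.3), §2 p. 28, §3 Thm. (3.11), (28)]
[cite: Disegni2020, Thm. 4 (§3.2)] [cite: Wuthrich2014, Thm. 16 (p. 397)] [cite: SilvermanATAEC1994, Thm. V.5.3, Cor. V.5.4]
[cite: Washington1997, Thm. 4.17] -/
theorem upperPartner_at_three_of_lineUnramifiedEven_of_thmE
    (hP : EisensteinPrimes.PublishedInputs)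
    (hDis : padicBSD_rankOne_nonsplitMult) (h311 : thm311_hasUnitContent_iff_and_order_eq_of_lineRamifiedEven)
    (hDD : ∀ (V : WeierstrassCurve ℚ) [V.IsElliptic] (ℓ : ℕ) [Fact ℓ.Prime], selmerCorank_mod_two_eq V ℓ)
    (hKY : thmE_pConverse_semistable_OPEN)
    (hNH : Literature.NumberTheory.QuadraticFields.nakagawaHorie_taya_exists_imaginary_h3_eq_one)
    (W : WeierstrassCurve ℚ) [W.IsElliptic] [W.IsGloballyMinimal]
    (hc : X2.CellB W 3) (hns : ¬ W.HasSplitMultiplicativeReductionAtPrime 3)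
    {Φ₀ : AddSubgroup (geomTorsion W ((3 : ℕ) : ℤ))} (hΦ : IsRationalLine W 3 Φ₀)
    (hunr : LineUnramifiedAt W 3 Φ₀) (hevenL : LineEven W 3 Φ₀)
    {m : ℕ} [NeZero m] (φ : DirichletCharacter (ZMod 3) m) {d : ℕ} [NeZero d]
    (ψ : DirichletCharacter (ZMod 3) d) (hφ : φ.IsPrimitive) (hψ : ψ.IsPrimitive) (h3m : ¬ 3 ∣ m)
    (h3d : 3 ∣ d) (hd3m : d ∣ 3 * m)
    (hDf : ((m : ℤ) % 4 = 1 ∧ Squarefree (m : ℤ) ∧ (m : ℤ) ≠ 1) ∨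
      (4 ∣ (m : ℤ) ∧ ((m : ℤ) / 4 % 4 = 2 ∨ (m : ℤ) / 4 % 4 = 3) ∧ Squarefree ((m : ℤ) / 4)))
    (hφ0 : ∀ (σ : absoluteGaloisGroup ℚ), ∀ P ∈ Φ₀,
      σ • P = (φ ((modNCyclotomicCharacter ℚ m σ : (ZMod m)ˣ) : ZMod m)).val • P)
    (hψ0 : ∀ (σ : absoluteGaloisGroup ℚ) (P : geomTorsion W ((3 : ℕ) : ℤ)),
      σ • P - (ψ ((modNCyclotomicCharacter ℚ d σ : (ZMod d)ˣ) : ZMod d)).val • P ∈ Φ₀)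
    (S₀ : Finset (HeightOneSpectrum (𝓞 ℚ))) (hS₀p : ∀ v ∈ S₀, ((3 : ℕ) : 𝓞 ℚ) ∉ v.asIdeal)
    (hS₀N : ∀ v ∈ S₀, Rat.HeightOneSpectrum.natGenerator v ∣ W.conductorNorm ℤ)
    (hS : ∀ v : HeightOneSpectrum (𝓞 ℚ), v ∉ S₀ → ((3 : ℕ) : 𝓞 ℚ) ∉ v.asIdeal → W.HasGoodReductionAt v)
    (hφe : φ.Even) (hφ3 : φ (3 : ZMod m) ≠ 1)
    (hφψ : ∀ a : ℕ, ¬ 3 ∣ a → φ (a : ZMod m) * (a : ZMod 3)⁻¹ = ψ⁻¹ (a : ZMod d))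
    (hbal : 1 + ∑ v ∈ S₀, delta W 3 v =
      ∑ v ∈ S₀, ((if φ (Rat.HeightOneSpectrum.natGenerator v : ZMod m) =
            (Rat.HeightOneSpectrum.natGenerator v : ZMod 3)
          then sFactor 3 (Rat.HeightOneSpectrum.natGenerator v) else 0) +
        (if ψ (Rat.HeightOneSpectrum.natGenerator v : ZMod d) =
            (Rat.HeightOneSpectrum.natGenerator v : ZMod 3)
          then sFactor 3 (Rat.HeightOneSpectrum.natGenerator v) else 0))) :
    ∃ (K : Type) (_ : Field K) (_ : NumberField K), IsImaginaryQuadratic K ∧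
      SatisfiesHeegnerHypothesis (W.conductorNorm ℤ) K ∧ SatisfiesHeegnerHypothesis 3 K ∧
      Odd (NumberField.discr K) ∧ NumberField.discr K < -4 ∧
      (W.quadraticTwist (NumberField.discr K : ℚ)).analyticRank = 1 ∧
      ∀ (Wd : WeierstrassCurve ℚ) [Wd.IsElliptic] [Wd.IsGloballyMinimal],
        (∃ C : VariableChange ℚ, C • Wd = W.quadraticTwist (NumberField.discr K : ℚ)) →
        MissingUpperBoundAt Wd 3 := by
  have h3P : (3 : ℕ).Prime := Fact.out
  refine EisensteinPrimesMazurMCOnCellBTwistbackBalanceOneDoor.upperPartner_at_three_of_dictionary_of_thmE hP hDis h311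
    hDD hKY hNH W hc hns (D := (m : ℤ)) (by exact_mod_cast Nat.pos_of_ne_zero (NeZero.ne m)) hDf ?_
  intro K _ _ hK hHN hH3 _ hodd hlt _ hcop hh _ Wd _ _ hWd
  obtain ⟨C, hC⟩ := hWd
  have h2 : Module.finrank ℚ K = 2 := hK.1
  haveI : NeZero (NumberField.discr K).natAbs := ⟨Int.natAbs_ne_zero.mpr (NumberField.discr_ne_zero K)⟩
  obtain ⟨hD4, hsqN⟩ := discr_emod_four_eq_one_and_squarefree_natAbs_of_odd h2 hodd
  obtain ⟨χ, -, -, hχJ, -⟩ := exists_quadraticChar_geomSqrt_of_emod_four (p := 3) (by decide) hD4 hsqN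
  -- coprimality of the conductors with `d_K`: `gcd(d_K, D) = 1` from the supply, `3 ∤ d_K` since `3` splits
  have hDcop : m.Coprime (NumberField.discr K).natAbs := by
    have h := (Int.isCoprime_iff_nat_coprime.mp hcop).symm
    rwa [Int.natAbs_natCast] at h
  have h3cop : (3 : ℕ).Coprime (NumberField.discr K).natAbs :=
    (Nat.Prime.coprime_iff_not_dvd h3P).mpr fun h ↦
      Literature.SatisfiesHeegnerHypothesis.not_dvd_discr h2 hH3 h3P dvd_rfl (Int.natCast_dvd.mpr h)
  have hOcop : d.Coprime (NumberField.discr K).natAbs :=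
    Nat.Coprime.coprime_dvd_left hd3m (Nat.Coprime.mul_left h3cop hDcop)
  exact klFlatCarrier_twist_of_lineUnramifiedEven_of_classNumber W (p := 3) (by decide) hc.2.1.2.2 K hK hodd hHN hH3 χ
    hχJ hΦ hunr hevenL φ ψ hφ hψ h3m h3d hDcop hOcop hφ0 hψ0 S₀ hS₀p hS₀N hS (isQuadratic_of_zmod_three φ) hφe hφψ hφ3
    hlt hh 1 hbal Wd C hC

end Summit.BirchSwinnertonDyer.BirchSwinnertonDyer.Theorems.EisensteinPrimesMazurMCOnCellBTwistbackTwistDoorDictionary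

end
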